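import Summits.Ventures.DiscreteObjects.PP12.FlagTenConjunctR2
import Summits.Ventures.DiscreteObjects.PP12.FlagTenConjunctR1Fin
import Summits.Ventures.DiscreteObjects.PP12.FlagTenConjunctC3Fin

/-!
# PP(12), flag sub-cell `f = 10`: the ORBIT-MATRIX REDUCTION holds (kernel; conjunct 7 transported and the assembly)
Framing: lottery ticket; floor = certified bounds/negative ranges.

Cell pub-namedobj (venture DiscreteObjects), target (M), designs gen 14 (HOME designs-g13 FAMILY-FLAG7X §7, designs g11–g14). For the orbit
data `D := flagTenDataOfPlane …` read off a putative projective plane of order 12 with a flag-type collineation `σ`, `σ³ = 1`, exactly 10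
fixed points, and a non-fixed line `u₀ ∋ c`:
* conjunct 7 ((R2)), `∀ k t i, #{j : D.β k j t = D.γ j i} + 2·[D.C k i = t] + [D.C k (D.φ⁻¹ i) = t] = 3` (**`flagTenDataOfPlane_R2`**, the
  transport of `FlagTenConjunctR2.side_tline_count`);
* **`isFlagTenOrbitMatrix_dataOfPlane`** — all ten conjuncts of `IsFlagTenOrbitMatrix D` (designs g12's typed statement p322607), assembled
  from `FlagTenDataFin` (1, 4), `FlagTenConjunctsColouring` (2, 3), `FlagTenConjunctR1Fin` (5), `FlagTenConjunctC1Fin` (6), this file (7),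
  `FlagTenConjunctR3Fin` (8), `FlagTenConjunctC3Fin` (9), `FlagTenConjunctC4Fin` (10);
* **`flagTenOrbitReduction_holds : FlagTenOrbitReduction`** — the typed census statement of `FlagTenOrbitMatrix` is now a theorem: every
  projective plane of order 12 with a collineation `σ ≠ 1`, `σ³ = 1`, of flag type with exactly 10 fixed points yields a `FlagTenOrbitData`
  satisfying `IsFlagTenOrbitMatrix` (choose `u₀` by `FlagTenIndexSets.exists_cline_not_fixed_ten`);
* `noFlagTenFixed_of_noOrbitMatrix : NoFlagTenOrbitMatrix → NoFlagOrder3Order12Fixed 10` — the `f = 10` flag sub-cell of the PP(12)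
  order-3 census is reduced IN THE KERNEL to the finite proposition `NoFlagTenOrbitMatrix`, which is decided EMPTY outside the kernel by two
  independent implementations (designs g11, g12; referee police verify-ref g110) — census words: 'f = 10 flag sub-cell: kernel reduction
  to `NoFlagTenOrbitMatrix`; orbit level EMPTY (two seats + referee, outside the kernel)'. Nothing here asserts `NoFlagTenOrbitMatrix`;
* `card_collineationGroup_eq_one_v6` — the rigid endgame of `FlagSubcells` (v5) with the `f = 10` hypothesis replaced by `NoFlagTenOrbitMatrix`.
Classical mathematics (tactical decompositions / orbit matrices, Dembowski §1.3, §4.1) formalised; no novelty claimed beyond the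
formalisation. No `sorry`, no new axioms.
-/

namespace Summit.Ventures.DiscreteObjects.PP12

open Configuration Finset
open scoped Classical

namespace Collineation

variable {P L : Type*} [Membership P L] [ProjectivePlane P L] [Fintype P] [Fintype L] (σ : Collineation P L)

section Data

variable {l : L} {c : P} (hl : σ.onLines l = l) (hc : σ.onPoints c = c) (hcl : c ∈ l)
  (hP : ∀ p : P, σ.onPoints p = p → p ∈ l) (hL : ∀ m : L, σ.onLines m = m → c ∈ m) (h12 : ProjectivePlane.order P L = 12)
  (hq : σ.onPoints ^ 3 = 1) (hf : fixedCard σ.onPoints = 10) {u₀ : L} (hcu₀ : c ∈ u₀) (hu₀ : σ.onLines u₀ ≠ u₀)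

set_option maxHeartbeats 400000 in
/-- **Conjunct 7 ((R2)).** (Heartbeats raised for the lane build's headroom, as for `flagTenDataOfPlane_C4`.) -/
theorem flagTenDataOfPlane_R2 (k : Fin 9) (t : Fin 4) (i : Fin 12) :
    (univ.filter fun j : Fin 9 => (σ.flagTenDataOfPlane hl hc hcl hP hL h12 hq hf hcu₀ hu₀).β k j t =
        (σ.flagTenDataOfPlane hl hc hcl hP hL h12 hq hf hcu₀ hu₀).γ j i).card
      + 2 * flagInd ((σ.flagTenDataOfPlane hl hc hcl hP hL h12 hq hf hcu₀ hu₀).C k i = t)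
      + flagInd ((σ.flagTenDataOfPlane hl hc hcl hP hL h12 hq hf hcu₀ hu₀).C k
          ((σ.flagTenDataOfPlane hl hc hcl hP hL h12 hq hf hcu₀ hu₀).φ.symm i) = t) = 3 := by
  set D := σ.flagTenDataOfPlane hl hc hcl hP hL h12 hq hf hcu₀ hu₀ with hD
  set e := eTri (P := P) h12 hcu₀ with he
  set eJ := σ.eFixL hl hc hf with heJ
  set y := σ.eFixP hl hc hf k with hy
  set eB := σ.eLOrb hl hcl hP hL h12 hq y with heB
  set x := e i with hx
  set v := e (D.φ.symm i) with hv
  -- a representative b of the line orbit t through y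
  obtain ⟨b, hb, hbeq⟩ := mem_image.1 (eB t).2
  rw [mem_filter] at hb
  -- unfold C, β, γ, φ
  have hC : ∀ i₀ : Fin 12, D.C k i₀ = eB.symm ⟨σ.cOrb l y.1 (e i₀).1,
      (σ.cOrb_mem hl hP (σ.exterior_of_mem_cline hL hcu₀ hu₀ (e i₀).2.1 (e i₀).2.2) y.2.1).1⟩ := fun i₀ => rfl
  have hβ : ∀ j : Fin 9, D.β k j t = (σ.eOrbOn hc hcl hP hL h12 hq (eJ j)).symm
      ⟨σ.betaOrb c (eJ j).1 (eB t).1, by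
          obtain ⟨b₁, hb₁, hb₁eq⟩ := mem_image.1 (eB t).2
          rw [mem_filter] at hb₁
          rw [← hb₁eq]
          exact σ.betaOrb_mem hc hcl hP hL hq y.2.1 y.2.2 hb₁.2.1 hb₁.2.2 (eJ j).2.1 (eJ j).2.2⟩ := fun j => rfl
  have hγ : ∀ (j : Fin 9) (i₀ : Fin 12), D.γ j i₀ = (σ.eOrbOn hc hcl hP hL h12 hq (eJ j)).symm
      ⟨σ.gammaOrb l c (eJ j).1 (e i₀).1,
        (σ.gammaOrb_mem hl hc hP hL (σ.exterior_of_mem_cline hL hcu₀ hu₀ (e i₀).2.1 (e i₀).2.2) (eJ j).2.1).1⟩ :=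
    fun j i₀ => rfl
  have hφ : ∀ i₀ : Fin 12, (e (D.φ i₀)).1 = σ.phiVertex l c u₀ (e i₀).1 := by
    intro i₀
    change (e ((((e.trans (σ.phiEquiv hl hc hcl hP hL h12 hq hf hcu₀ hu₀)).trans e.symm)) i₀)).1 = _
    simp only [Equiv.trans_apply, Equiv.apply_symm_apply]
    rfl
  have hφv : σ.phiVertex l c u₀ v.1 = x.1 := by
    rw [hv, ← hφ (D.φ.symm i), Equiv.apply_symm_apply]
  -- C-conditions at plane level
  have hiffC : ∀ i₀ : Fin 12, D.C k i₀ = t ↔ σ.cOrb l y.1 (e i₀).1 = orb3 σ.onLines b := by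
    intro i₀
    rw [hC]
    constructor
    · intro h1
      have := congrArg (fun s => (eB s).1) h1; simp at this; rw [this, hbeq]
    · intro h1
      apply eB.injective; rw [Equiv.apply_symm_apply]; apply Subtype.ext
      change σ.cOrb l y.1 (e i₀).1 = (eB t).1; rw [h1, hbeq]
  have hI1 : flagInd (D.C k i = t) = flagInd (σ.cOrb l y.1 x.1 = orb3 σ.onLines b) := by
    unfold flagInd
    by_cases h : σ.cOrb l y.1 x.1 = orb3 σ.onLines b
    · rw [if_pos h, if_pos ((hiffC i).2 h)]
    · rw [if_neg h, if_neg (fun h' => h ((hiffC i).1 h'))]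
  have hI2 : flagInd (D.C k (D.φ.symm i) = t) = flagInd (σ.cOrb l y.1 v.1 = orb3 σ.onLines b) := by
    unfold flagInd
    by_cases h : σ.cOrb l y.1 v.1 = orb3 σ.onLines b
    · rw [if_pos h, if_pos ((hiffC (D.φ.symm i)).2 h)]
    · rw [if_neg h, if_neg (fun h' => h ((hiffC (D.φ.symm i)).1 h'))]
  -- the filter at plane level
  have hset : (univ.filter fun j : Fin 9 => D.β k j t = D.γ j i)
      = univ.filter fun j : Fin 9 => σ.betaOrb c (eJ j).1 (orb3 σ.onLines b) = σ.gammaOrb l c (eJ j).1 x.1 := by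
    ext j
    simp only [mem_filter, mem_univ, true_and]
    rw [hβ, hγ]
    constructor
    · intro h1
      have := congrArg Subtype.val ((σ.eOrbOn hc hcl hP hL h12 hq (eJ j)).symm.injective h1)
      dsimp only at this
      rw [← hbeq] at this
      exact this
    · intro h1
      refine congrArg _ (Subtype.ext ?_)
      change σ.betaOrb c (eJ j).1 (eB t).1 = σ.gammaOrb l c (eJ j).1 x.1
      rw [← hbeq]
      exact h1
  rw [hset, hI1, hI2]
  have h2 := σ.card_filter_eFixL hl hc hf (fun m => σ.betaOrb c m (orb3 σ.onLines b) = σ.gammaOrb l c m x.1)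
  rw [← heJ] at h2
  have h3 := σ.side_tline_count hl hc hcl hP hL h12 hq hf hcu₀ hu₀ x.2.1 x.2.2 v.2.1 v.2.2 hφv y.2.1 y.2.2 hb.2.1 hb.2.2
  have hJ : (univ.filter fun j : Fin 9 => σ.betaOrb c (eJ j).1 (orb3 σ.onLines b) = σ.gammaOrb l c (eJ j).1 x.1).card
      = (univ.filter fun m : L => σ.onLines m = m ∧ m ≠ l ∧
          σ.betaOrb c m (orb3 σ.onLines b) = σ.gammaOrb l c m x.1).card := by
    convert h2 using 2 <;> (ext m; simp only [mem_filter, mem_univ, true_and])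
  rw [hJ]
  exact h3

/-- **All ten conjuncts:** the orbit data read off the plane satisfy `IsFlagTenOrbitMatrix`. -/
theorem isFlagTenOrbitMatrix_dataOfPlane : IsFlagTenOrbitMatrix (σ.flagTenDataOfPlane hl hc hcl hP hL h12 hq hf hcu₀ hu₀) :=
  ⟨σ.flagTenDataOfPlane_phi hl hc hcl hP hL h12 hq hf hcu₀ hu₀,
    σ.flagTenDataOfPlane_gamma hl hc hcl hP hL h12 hq hf hcu₀ hu₀,
    σ.flagTenDataOfPlane_C hl hc hcl hP hL h12 hq hf hcu₀ hu₀,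
    σ.flagTenDataOfPlane_beta_bijective hl hc hcl hP hL h12 hq hf hcu₀ hu₀,
    σ.flagTenDataOfPlane_R1 hl hc hcl hP hL h12 hq hf hcu₀ hu₀,
    σ.flagTenDataOfPlane_C1 hl hc hcl hP hL h12 hq hf hcu₀ hu₀,
    σ.flagTenDataOfPlane_R2 hl hc hcl hP hL h12 hq hf hcu₀ hu₀,
    σ.flagTenDataOfPlane_R3 hl hc hcl hP hL h12 hq hf hcu₀ hu₀,
    σ.flagTenDataOfPlane_C3 hl hc hcl hP hL h12 hq hf hcu₀ hu₀,
    σ.flagTenDataOfPlane_C4 hl hc hcl hP hL h12 hq hf hcu₀ hu₀⟩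

end Data

end Collineation

/-- **The orbit-matrix reduction of the `f = 10` flag sub-cell holds** (designs g12's typed statement `FlagTenOrbitReduction`, p322607,
is a theorem): every projective plane of order 12 with a flag-type collineation `σ ≠ 1`, `σ³ = 1`, with exactly 10 fixed points yields
orbit data satisfying `IsFlagTenOrbitMatrix`. -/
theorem flagTenOrbitReduction_holds : FlagTenOrbitReduction := by
  intro P L _ _ _ _ h12 σ hq _ hflag
  obtain ⟨l, c, hl, hc, hcl, hP, hL, hf⟩ := hflag
  obtain ⟨u₀, hcu₀, hu₀⟩ := σ.exists_cline_not_fixed_ten (c := c) h12 hf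
  exact ⟨_, σ.isFlagTenOrbitMatrix_dataOfPlane hl hc hcl hP hL h12 hq hf hcu₀ hu₀⟩

/-- **Census consequence (pure logic):** if no orbit matrix of the `f = 10` flag sub-cell exists (`NoFlagTenOrbitMatrix`, decided EMPTY
by computation OUTSIDE the kernel), then no projective plane of order 12 admits a flag-type collineation of order 3 with exactly 10 fixed
points (`NoFlagOrder3Order12Fixed 10`). -/
theorem noFlagTenFixed_of_noOrbitMatrix (hno : NoFlagTenOrbitMatrix) : NoFlagOrder3Order12Fixed 10 :=
  noFlagTen_of_orbitReduction flagTenOrbitReduction_holds hno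

open Literature.Combinatorics.Designs Summit.Ventures.DiscreteObjects.STD in
/-- **Rigid endgame, v6** (`FlagSubcells.card_collineationGroup_eq_one_v5` with the `f = 10` sub-cell hypothesis replaced by the FINITE
statement `NoFlagTenOrbitMatrix`, via `noFlagTenFixed_of_noOrbitMatrix`): Janko–van Trung's `{2,3}`-group theorem (named fact), the array
statements of the involution and order-3 elation cells, the typed flag sub-cells `f = 1, 4, 7` and the orbit-matrix statement of the
`f = 10` sub-cell force every collineation group of a projective plane of order 12 to be trivial. Census status 2026-08-22: `hF1, hF4, hF7`
'typed / undecided'; `hF10` decided EMPTY by two independent computations outside the kernel (not asserted here). -/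
theorem card_collineationGroup_eq_one_v6 (hJvT : CollineationGroupIsTwoThreeGroup)
    (h2 : NoLiftableSTD2_12_6) (h3E : NoLiftableSTD3_12_4)
    (hF1 : NoFlagOrder3Order12Fixed 1) (hF4 : NoFlagOrder3Order12Fixed 4) (hF7 : NoFlagOrder3Order12Fixed 7)
    (hF10 : NoFlagTenOrbitMatrix)
    (P L : Type) [Membership P L] [Fintype P] [Fintype L] [ProjectivePlane P L] (h12 : ProjectivePlane.order P L = 12)
    (G : Type) [Group G] [Fintype G] [MulAction G P] [MulAction G L] (hG : IsCollineationGroup G P L) :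
    Fintype.card G = 1 :=
  card_collineationGroup_eq_one_v5 hJvT h2 h3E hF1 hF4 hF7 (noFlagTenFixed_of_noOrbitMatrix hF10) P L h12 G hG

end Summit.Ventures.DiscreteObjects.PP12
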